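import Summits.ResolutionOfSingularities.ResolutionOfSingularities.Theorems.FrobeniusLadderFInjectiveMacaulayficationReductions

/-!
# Crux `FInjectiveMacaulayfication`: the ISOLATION SPLIT (crux-strategist, BC2 redirect)

Support file for crux `stmt-ResolutionOfSingularities-15315` (`FrobeniusLadder.FInjectiveMacaulayfication`, route
`ResolutionOfSingularities/FrobeniusLadder`, rung 2). It proves, sorry-free, the ASSEMBLY of the typed decomposition

  `FInjectiveIsolation ∧ IsolatedFInjectivization → FInjectiveMacaulayfication`

along the fault line the crux's own evidence exhibits (point centres F-injectivize isolated non-F-injective germs —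
`E8Char5FiModel`, the char-3 tower `E7Char3FiModel`, the threefold item `ThreefoldFInjectiveBlowup` — but die once the
non-F-injective locus is a curve, survey j023222):

* `FInjectiveIsolation` (ISO, "F-injective Macaulayfication away from finitely many points"): every INTEGRAL separated
  finite-type `X/k`, `char k = p`, has a proper birational INTEGRAL model `X₁` all of whose local rings are Cohen–Macaulay
  (every system of parameters is a weakly regular sequence) and whose set of points `x` at which some parameter ideal of
  `𝒪_{X₁,x}` fails to be Frobenius closed is FINITE;
* `IsolatedFInjectivization` (PT, "isolated non-F-injective points can be F-injectivized"): an integral separated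
  finite-type `X₁/k`, `char k = p`, with Cohen–Macaulay local rings and finitely many points with a non-Frobenius-closed
  parameter ideal has a proper birational model whose stalks satisfy the crux's clause verbatim (domain, every s.o.p.
  weakly regular, every parameter ideal Frobenius closed).

`fInjectiveMacaulayfication_of_isolation_of_isolated`: ISO → PT → crux. Proof: by
`fInjectiveMacaulayfication_iff_integral` it suffices to treat integral `X`; take the ISO model `π₁ : X₁ → X`, apply PT to
`X₁` (structure map `π₁ ≫ f`: separated, locally of finite type and quasi-compact as a composite with the proper `π₁`),
and compose — proper ∘ proper is proper, birational ∘ birational is birational (`ComponentGluing.IsBirational.comp`), and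
the top model is integral because it is birational over the integral `X₁` with domain stalks
(`isIntegral_of_isBirational_of_isDomain_stalk`). Both hypotheses are written out verbatim (they are the statements of
the two child items of the route split; no definition is introduced). The converse directions `crux → ISO`, `crux → PT`
(each piece is a consequence of the crux, hence of the summit) are `isolation_of_fInjectiveMacaulayfication` and
`isolated_of_fInjectiveMacaulayfication`. [folklore]
-/

-- single-problem summit: the doubled namespace component is forced
set_option linter.dupNamespace false

noncomputable section

namespace Summit.ResolutionOfSingularities.ResolutionOfSingularities.Theorems.FInjectiveMacaulayfication.Split

open AlgebraicGeometry CategoryTheory Literature.AlgebraicGeometry.Resolution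
open Summit.ResolutionOfSingularities.ResolutionOfSingularities.Theses.FrobeniusLadder

/-- **ISOLATION SPLIT, assembly**: `FInjectiveIsolation → IsolatedFInjectivization → FInjectiveMacaulayfication`
(both hypotheses verbatim = the two child items of the route split of crux `FInjectiveMacaulayfication`). [folklore] -/
theorem fInjectiveMacaulayfication_of_isolation_of_isolated
    (hI : ∀ p : ℕ, p.Prime → ∀ (k : Type) [Field k] [CharP k p] (X : AlgebraicGeometry.Scheme.{0}) (f : X ⟶ AlgebraicGeometry.Spec (.of k)), AlgebraicGeometry.IsSeparated f → AlgebraicGeometry.LocallyOfFiniteType f → AlgebraicGeometry.QuasiCompact f → AlgebraicGeometry.IsIntegral X → ∃ (X₁ : AlgebraicGeometry.Scheme.{0}) (π : X₁ ⟶ X), AlgebraicGeometry.IsProper π ∧ Literature.AlgebraicGeometry.Resolution.IsBirational π ∧ AlgebraicGeometry.IsIntegral X₁ ∧ (∀ x : X₁, ∀ d : ℕ, ringKrullDim (X₁.presheaf.stalk x) = d → ∀ s : Fin d → X₁.presheaf.stalk x, (Ideal.span (Set.range s)).radical.IsMaximal → RingTheory.Sequence.IsWeaklyRegular (X₁.presheaf.stalk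 x) (List.ofFn s)) ∧ Set.Finite {x : X₁ | ¬ ∀ d : ℕ, ringKrullDim (X₁.presheaf.stalk x) = d → ∀ s : Fin d → X₁.presheaf.stalk x, (Ideal.span (Set.range s)).radical.IsMaximal → ∀ y : X₁.presheaf.stalk x, (∃ e : ℕ, y ^ p ^ e ∈ Ideal.span ((fun z : X₁.presheaf.stalk x => z ^ p ^ e) '' (Ideal.span (Set.range s) : Set (X₁.presheaf.stalk x)))) → y ∈ Ideal.span (Set.range s)})
    (hP : ∀ p : ℕ, p.Prime → ∀ (k : Type) [Field k] [CharP k p] (X₁ : AlgebraicGeometry.Scheme.{0}) (f₁ : X₁ ⟶ AlgebraicGeometry.Spec (.of k)), AlgebraicGeometry.IsSeparated f₁ → AlgebraicGeometry.LocallyOfFiniteType f₁ → AlgebraicGeometry.QuasiCompact f₁ → AlgebraicGeometry.IsIntegral X₁ → (∀ x : X₁, ∀ d : ℕ, ringKrullDim (X₁.presheaf.stalk x) = d → ∀ s : Fin d → X₁.presheaf.stalk x, (Ideal.span (Set.range s)).radical.IsMaximal → RingTheory.Sequence.IsWeaklyRegular (X₁.presheaf.stalk x) (List.ofFn s)) →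 Set.Finite {x : X₁ | ¬ ∀ d : ℕ, ringKrullDim (X₁.presheaf.stalk x) = d → ∀ s : Fin d → X₁.presheaf.stalk x, (Ideal.span (Set.range s)).radical.IsMaximal → ∀ y : X₁.presheaf.stalk x, (∃ e : ℕ, y ^ p ^ e ∈ Ideal.span ((fun z : X₁.presheaf.stalk x => z ^ p ^ e) '' (Ideal.span (Set.range s) : Set (X₁.presheaf.stalk x)))) → y ∈ Ideal.span (Set.range s)} → ∃ (X' : AlgebraicGeometry.Scheme.{0}) (π : X' ⟶ X₁), AlgebraicGeometry.IsProper π ∧ Literature.AlgebraicGeometry.Resolution.IsBirational π ∧ ∀ x : X', IsDomain (X'.presheaf.stalk x) ∧ ∀ d : ℕ, ringKrullDim (X'.presheaf.stalk x) = d → ∀ s : Fin d → X'.presheaf.stalk x, (Ideal.span (Set.range s)).radical.IsMaximal → RingTheory.Sequence.IsWeaklyRegular (X'.presheaf.stalk x) (List.ofFn s) ∧ ∀ y : X'.presheaf.stalk x, (∃ e : ℕ, y ^ p ^ e ∈ Ideal.span ((fun z : X'.presheaf.stalk x => z ^ p ^ e) '' (Ideal.span (Set.range s) : Set (X'.presheaf.stalk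 x)))) → y ∈ Ideal.span (Set.range s)) :
    FInjectiveMacaulayfication := by
  refine fInjectiveMacaulayfication_iff_integral.mpr ?_
  intro p hp k _ _ X f hsep hft hqc hint
  obtain ⟨X₁, π₁, hπ₁, hbir₁, hint₁, hCM, hfin⟩ := hI p hp k X f hsep hft hqc hint
  haveI := hπ₁
  haveI := hsep
  haveI := hft
  haveI := hqc
  have hsep₁ : IsSeparated (π₁ ≫ f) := inferInstance
  have hft₁ : LocallyOfFiniteType (π₁ ≫ f) := inferInstance
  have hqc₁ : QuasiCompact (π₁ ≫ f) := inferInstance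
  obtain ⟨X', π, hπ, hbir, hgood⟩ := hP p hp k X₁ (π₁ ≫ f) hsep₁ hft₁ hqc₁ hint₁ hCM hfin
  haveI := hπ
  haveI := hint₁
  exact ⟨X', π ≫ π₁, inferInstance, ComponentGluing.IsBirational.comp hbir hbir₁,
    isIntegral_of_isBirational_of_isDomain_stalk (ComponentGluing.IsBirational.comp hbir hbir₁)
      fun x => (hgood x).1, hgood⟩

/-- **The crux implies the isolation piece** (`FInjectiveMacaulayfication → FInjectiveIsolation`): over an integral
`X` the crux's model is integral (`fInjectiveMacaulayfication_iff_integral`), its stalks are Cohen–Macaulay, and its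
non-F-injective set is EMPTY, hence finite. So the piece is a consequence of the crux (and of the summit). [folklore] -/
theorem isolation_of_fInjectiveMacaulayfication (h : FInjectiveMacaulayfication) :
    ∀ p : ℕ, p.Prime → ∀ (k : Type) [Field k] [CharP k p] (X : AlgebraicGeometry.Scheme.{0}) (f : X ⟶ AlgebraicGeometry.Spec (.of k)), AlgebraicGeometry.IsSeparated f → AlgebraicGeometry.LocallyOfFiniteType f → AlgebraicGeometry.QuasiCompact f → AlgebraicGeometry.IsIntegral X → ∃ (X₁ : AlgebraicGeometry.Scheme.{0}) (π : X₁ ⟶ X), AlgebraicGeometry.IsProper π ∧ Literature.AlgebraicGeometry.Resolution.IsBirational π ∧ AlgebraicGeometry.IsIntegral X₁ ∧ (∀ x : X₁, ∀ d : ℕ, ringKrullDim (X₁.presheaf.stalk x) = d → ∀ s : Fin d → X₁.presheaf.stalk x, (Ideal.span (Set.range s)).radical.IsMaximal → RingTheory.Sequence.IsWeaklyRegular (X₁.presheaf.stalk x) (List.ofFn s)) ∧ Set.Finite {x : X₁ | ¬ ∀ d : ℕ, ringKrullDim (X₁.presheaf.stalk x) = d → ∀ s : Fin d → X₁.presheaf.stalk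 x, (Ideal.span (Set.range s)).radical.IsMaximal → ∀ y : X₁.presheaf.stalk x, (∃ e : ℕ, y ^ p ^ e ∈ Ideal.span ((fun z : X₁.presheaf.stalk x => z ^ p ^ e) '' (Ideal.span (Set.range s) : Set (X₁.presheaf.stalk x)))) → y ∈ Ideal.span (Set.range s)} := by
  intro p hp k _ _ X f hsep hft hqc hint
  obtain ⟨X₁, π, hprop, hbir, hint₁, hfi⟩ :=
    fInjectiveMacaulayfication_iff_integral.mp h p hp k X f hsep hft hqc hint
  refine ⟨X₁, π, hprop, hbir, hint₁, fun x d hd s hs => ((hfi x).2 d hd s hs).1, ?_⟩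
  have hempty : {x : X₁ | ¬ ∀ d : ℕ, ringKrullDim (X₁.presheaf.stalk x) = d → ∀ s : Fin d → X₁.presheaf.stalk x,
      (Ideal.span (Set.range s)).radical.IsMaximal → ∀ y : X₁.presheaf.stalk x,
        (∃ e : ℕ, y ^ p ^ e ∈ Ideal.span ((fun z : X₁.presheaf.stalk x => z ^ p ^ e) ''
          (Ideal.span (Set.range s) : Set (X₁.presheaf.stalk x)))) → y ∈ Ideal.span (Set.range s)} = ∅ := by
    ext x
    simp only [Set.mem_setOf_eq, Set.mem_empty_iff_false, iff_false, not_not]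
    intro d hd s hs
    exact ((hfi x).2 d hd s hs).2
  rw [hempty]
  exact Set.finite_empty

/-- **The crux implies the isolated piece** (`FInjectiveMacaulayfication → IsolatedFInjectivization`): an integral
scheme is reduced, so the crux applies to `X₁` outright (neither the Cohen–Macaulay hypothesis nor the finiteness of
the non-F-injective set is consumed). [folklore] -/
theorem isolated_of_fInjectiveMacaulayfication (h : FInjectiveMacaulayfication) :
    ∀ p : ℕ, p.Prime → ∀ (k : Type) [Field k] [CharP k p] (X₁ : AlgebraicGeometry.Scheme.{0}) (f₁ : X₁ ⟶ AlgebraicGeometry.Spec (.of k)), AlgebraicGeometry.IsSeparated f₁ → AlgebraicGeometry.LocallyOfFiniteType f₁ → AlgebraicGeometry.QuasiCompact f₁ → AlgebraicGeometry.IsIntegral X₁ → (∀ x : X₁, ∀ d : ℕ, ringKrullDim (X₁.presheaf.stalk x) = d → ∀ s : Fin d → X₁.presheaf.stalk x, (Ideal.span (Set.range s)).radical.IsMaximal → RingTheory.Sequence.IsWeaklyRegular (X₁.presheaf.stalk x) (List.ofFn s)) → Set.Finite {x : X₁ | ¬ ∀ d : ℕ, ringKrullDim (X₁.presheaf.stalk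 x) = d → ∀ s : Fin d → X₁.presheaf.stalk x, (Ideal.span (Set.range s)).radical.IsMaximal → ∀ y : X₁.presheaf.stalk x, (∃ e : ℕ, y ^ p ^ e ∈ Ideal.span ((fun z : X₁.presheaf.stalk x => z ^ p ^ e) '' (Ideal.span (Set.range s) : Set (X₁.presheaf.stalk x)))) → y ∈ Ideal.span (Set.range s)} → ∃ (X' : AlgebraicGeometry.Scheme.{0}) (π : X' ⟶ X₁), AlgebraicGeometry.IsProper π ∧ Literature.AlgebraicGeometry.Resolution.IsBirational π ∧ ∀ x : X', IsDomain (X'.presheaf.stalk x) ∧ ∀ d : ℕ, ringKrullDim (X'.presheaf.stalk x) = d → ∀ s : Fin d → X'.presheaf.stalk x, (Ideal.span (Set.range s)).radical.IsMaximal → RingTheory.Sequence.IsWeaklyRegular (X'.presheaf.stalk x) (List.ofFn s) ∧ ∀ y : X'.presheaf.stalk x, (∃ e : ℕ, y ^ p ^ e ∈ Ideal.span ((fun z : X'.presheaf.stalk x => z ^ p ^ e) '' (Ideal.span (Set.range s) : Set (X'.presheaf.stalk x)))) → y ∈ Ideal.span (Set.range s) := by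
  intro p hp k _ _ X₁ f₁ hsep hft hqc hint _ _
  exact h p hp k X₁ f₁ hsep hft hqc inferInstance

end Summit.ResolutionOfSingularities.ResolutionOfSingularities.Theorems.FInjectiveMacaulayfication.Split

end
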